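import Summits.Ventures.PercRepro.RankLevelSetUpFivePreimage
import Summits.Ventures.PercRepro.RankLevelSetUpFiveBad
import Summits.Ventures.PercRepro.RankLevelSetUpFiveDeletion
import Summits.Ventures.PercRepro.RankLevelSetPerElemChainTriple
import Summits.Ventures.PercRepro.RankLevelSetUpFiveSeries

/-! # RankLevelSetUpFiveCosimple — THE 12-ELEMENT CASE OF THE RESIDUE (P) ON A COSIMPLE MATROID WHOSE DUAL HAS NO
FIVE COLLINEAR POINTS (night-1 g44; dossier §56.5–56.6; the swap count assembled)

`M` loopless, coloop-free, of nullity `5` on `12` elements, with `M✶` SIMPLE (no two parallel elements of `M✶`,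
i.e. no series pair of `M`) and every rank-`≤ 2` set of `M✶` of at most four elements. Then the coloop residue
`UpFiveDeletionResidue M b` holds at every `b` (**`upFiveDeletionResidue_of_cosimple`**), hence (↑)₅ at every `b`
(**`upAt_five_of_cosimple`**, through the deletion-averaging step `upAt_five_of_contract_of_residue`, whose
inductive hypothesis on the 11-element contractions is the middle identity). THE COUNT (§56.5): every through-`b`
complement has at most three coloops (`coloops_le_three`, the g37 bound in the dual); the bad members (three coloops)
each have at least six type-B targets `(Z, t)` (`six_le_ncard_typeBTargets_of_simple`), every target is a pair counted
by the right-hand side of (P) (`typeB_target_mem_avoid`), and every pair has at most five bad preimages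
(`ncard_preimages_le_five`), so `6·#bad ≤ 5·#pairs`, `#bad ≤ #pairs`, and
`Σ_W c₀(W) ≤ 2·T₅ + #bad ≤ 2·T₅ + Σ_Z c₀'(Z)`. Every declaration has a docstring; imports: the cell's own modules
and Mathlib only. Axioms: standard. -/

namespace PercRepro

open Set Matroid

variable {α : Type}

/-! ## Two counting lemmas -/

/-- **A double count over two finite sets of arbitrary types**:
`Σ_{x ∈ A} #{y ∈ B : p x y} = Σ_{y ∈ B} #{x ∈ A : p x y}`. -/
lemma sum_ncard_comm' {X Y : Type} {A : Set X} (hA : A.Finite) {B : Set Y} (hB : B.Finite) (p : X → Y → Prop) :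
    ∑ x ∈ hA.toFinset, {y ∈ B | p x y}.ncard = ∑ y ∈ hB.toFinset, {x ∈ A | p x y}.ncard := by
  classical
  have h1 : ∀ x, {y ∈ B | p x y}.ncard = (hB.toFinset.filter (fun y => p x y)).card := by
    intro x
    rw [← Set.ncard_coe_finset]
    congr 1
    ext y
    simp only [Finset.coe_filter, Set.Finite.mem_toFinset, Set.mem_setOf_eq]
  have h2 : ∀ y, {x ∈ A | p x y}.ncard = (hA.toFinset.filter (fun x => p x y)).card := by
    intro y
    rw [← Set.ncard_coe_finset]
    congr 1
    ext x
    simp only [Finset.coe_filter, Set.Finite.mem_toFinset, Set.mem_setOf_eq]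
  simp only [h1, h2, Finset.card_filter]
  exact Finset.sum_comm

/-- **The pairs `(y, x)` with `y ∈ B` and `x ∈ f y` are counted by `Σ_{y ∈ B} #(f y)`.** -/
lemma ncard_pairs_eq_sum {X Y : Type} {B : Set Y} (hB : B.Finite) (f : Y → Set X) (hf : ∀ y ∈ B, (f y).Finite) :
    {τ : Y × X | τ.1 ∈ B ∧ τ.2 ∈ f τ.1}.ncard = ∑ y ∈ hB.toFinset, (f y).ncard := by
  classical
  -- the finite set of pairs
  let g : Y → Finset (Y × X) := fun y =>
    if h : y ∈ B then ((hf y h).toFinset.map ⟨fun x => (y, x), fun _ _ h => (Prod.mk.inj h).2⟩) else ∅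
  have hset : {τ : Y × X | τ.1 ∈ B ∧ τ.2 ∈ f τ.1} = ↑(hB.toFinset.biUnion g) := by
    ext ⟨y, x⟩
    simp only [Set.mem_setOf_eq, Finset.coe_biUnion, Set.Finite.coe_toFinset, Set.mem_iUnion, Finset.mem_coe,
      exists_prop, g]
    constructor
    · rintro ⟨hy, hx⟩
      refine ⟨y, hy, ?_⟩
      rw [dif_pos hy, Finset.mem_map]
      exact ⟨x, (hf y hy).mem_toFinset.mpr hx, rfl⟩
    · rintro ⟨y', hy', hmem⟩
      rw [dif_pos hy', Finset.mem_map] at hmem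
      obtain ⟨x', hx', hxy⟩ := hmem
      simp only [Function.Embedding.coeFn_mk, Prod.mk.injEq] at hxy
      obtain ⟨rfl, rfl⟩ := hxy
      exact ⟨hy', (hf y' hy').mem_toFinset.mp hx'⟩
  rw [hset, Set.ncard_coe_finset, Finset.card_biUnion]
  · refine Finset.sum_congr rfl ?_
    intro y hy
    rw [Set.Finite.mem_toFinset] at hy
    simp only [g, dif_pos hy, Finset.card_map]
    exact (Set.ncard_eq_toFinset_card _ (hf y hy)).symm
  · intro y hy y' hy' hne
    rw [Set.Finite.coe_toFinset] at hy hy'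
    rw [Function.onFun, Finset.disjoint_left]
    intro τ hτ hτ'
    simp only [g, dif_pos hy, Finset.mem_map, Function.Embedding.coeFn_mk] at hτ
    simp only [g, dif_pos hy', Finset.mem_map, Function.Embedding.coeFn_mk] at hτ'
    obtain ⟨x, -, rfl⟩ := hτ
    obtain ⟨x', -, h⟩ := hτ'
    exact hne (Prod.mk.inj h).1.symm

/-! ## The coloop count of a through-`b` complement -/

variable (M : Matroid α) [M.Finite]

/-- **Every complement of a bi-independent `5`-set has at most three coloops in the dual** (`M` coloop-free without
a series triple, of nullity `≤ 5`, with `≥ 12` elements): the g37 bound `#coloops + 2 ≤ ρ` on `E ∖ W`. -/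
lemma coloops_le_three (hcol : ∀ e, ¬ M.IsColoop e) (hnt : NoSeriesTriple M) (hν : M✶.eRank ≤ 5)
    (hn : 12 ≤ M.E.ncard) {W : Set α} (hW : W ∈ biIndep M 5) :
    {t ∈ M.E \ W | t ∈ M.closure W}.ncard ≤ 3 := by
  rw [compl_closure_eq_dual_coloops M hW]
  have hYE : M.E \ W ⊆ M✶.E := by rw [Matroid.dual_ground]; exact Set.sdiff_subset
  have hnl : ∀ e ∈ M.E \ W, M✶.IsNonloop e := fun e he => dual_isNonloop_of_coloopFree M hcol he.1
  have hnt' := dual_no_parallel_triple M hcol hnt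
  have hρ : M✶.eRk (M.E \ W) ≤ ((5 : ℕ) : ℕ∞) := by
    rw [Nat.cast_ofNat]; exact (M✶.eRk_le_eRank _).trans hν
  have hY7 : 5 + 1 < (M.E \ W).ncard := by
    rw [Set.ncard_sdiff' hW.1 M.ground_finite, hW.2.1]; omega
  have h := ncard_coloops_add_two_le (ρ := 5) hYE hnl
    (fun p hp q hq r hr => hnt' p (hYE hp) q (hYE hq) r (hYE hr)) hρ hY7
  omega

/-- **The sum of the coloop counts is at most `2·T₅` plus the number of bad members** (those with three coloops). -/
lemma sum_coloops_le (hcol : ∀ e, ¬ M.IsColoop e) (hnt : NoSeriesTriple M) (hν : M✶.eRank ≤ 5)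
    (hn : 12 ≤ M.E.ncard) (b : α) :
    ∑ W ∈ (through_finite M b 5).toFinset, {t ∈ M.E \ W | t ∈ M.closure W}.ncard ≤
      2 * {W ∈ biIndep M 5 | b ∈ W}.ncard +
        {W ∈ biIndep M 5 | b ∈ W ∧ {t ∈ M.E \ W | t ∈ M.closure W}.ncard = 3}.ncard := by
  classical
  have hpt : ∀ W ∈ (through_finite M b 5).toFinset, {t ∈ M.E \ W | t ∈ M.closure W}.ncard ≤
      2 + (if {t ∈ M.E \ W | t ∈ M.closure W}.ncard = 3 then 1 else 0) := by
    intro W hW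
    rw [Set.Finite.mem_toFinset] at hW
    have h3 := coloops_le_three M hcol hnt hν hn hW.1
    split_ifs with h <;> omega
  refine (Finset.sum_le_sum hpt).trans ?_
  rw [Finset.sum_add_distrib, Finset.sum_const, smul_eq_mul, Finset.sum_boole,
    ← Set.ncard_eq_toFinset_card _ (through_finite M b 5)]
  have heq : {W ∈ biIndep M 5 | b ∈ W ∧ {t ∈ M.E \ W | t ∈ M.closure W}.ncard = 3} =
      ↑((through_finite M b 5).toFinset.filter (fun W => {t ∈ M.E \ W | t ∈ M.closure W}.ncard = 3)) := by
    ext W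
    simp only [Set.mem_setOf_eq, Finset.coe_filter, Set.Finite.mem_toFinset]
    tauto
  rw [heq, Set.ncard_coe_finset]
  simp only [Nat.cast_id]
  omega

/-! ## The bad members, read in the dual -/

/-- **A bad member has the decomposition of §56.5 in the dual**: `M` coloop-free without a series triple, of nullity
`5` on `12` elements, with every rank-`≤ 2` set of `M✶` of at most four elements; `W ∈ D_5` through `b` with three
coloops `C := {t ∈ E ∖ W : t ∈ cl_M W}` and line `L' := (E ∖ W) ∖ C`. Then `L'` has rank `2` in `M✶` and four
points, the elements of `C` are coloops of `M✶|(E ∖ W)`, `cl✶ L' = L'`, and `rk✶ (C ∪ L') = 5`. -/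
lemma bad_structure (hν : M✶.eRank = 5)
    (hn : M.E.ncard = 12) (hline : ∀ L ⊆ M.E, M✶.eRk L ≤ 2 → L.ncard ≤ 4) {W : Set α}
    (hW : W ∈ biIndep M 5) (hC3 : {t ∈ M.E \ W | t ∈ M.closure W}.ncard = 3) :
    M✶.eRk ((M.E \ W) \ {t ∈ M.E \ W | t ∈ M.closure W}) = 2 ∧
    ((M.E \ W) \ {t ∈ M.E \ W | t ∈ M.closure W}).ncard = 4 ∧
    (∀ x ∈ {t ∈ M.E \ W | t ∈ M.closure W}, x ∉ M✶.closure ((M.E \ W) \ {x})) ∧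
    M✶.closure ((M.E \ W) \ {t ∈ M.E \ W | t ∈ M.closure W}) = (M.E \ W) \ {t ∈ M.E \ W | t ∈ M.closure W} ∧
    M✶.eRk (M.E \ W) = 5 := by
  set C := {t ∈ M.E \ W | t ∈ M.closure W} with hCdef
  set L' := (M.E \ W) \ C with hL'def
  have hYsp : M✶.Spanning (M.E \ W) := dual_spanning_compl_of_indep M hW.2.2.1
  have hY5 : M✶.eRk (M.E \ W) = 5 := by rw [hYsp.eRk_eq, hν]
  have hsplit := eRk_dual_compl_eq_add_coloops M hW
  rw [← hCdef, ← hL'def, hC3, hY5] at hsplit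
  have hL2 : M✶.eRk L' = 2 := by
    have hsplit' : M✶.eRk L' + 3 = 5 := by rw [Nat.cast_ofNat] at hsplit; exact hsplit.symm
    have h : M✶.eRk L' + 3 = 2 + 3 := by rw [hsplit']; norm_num
    exact WithTop.add_right_cancel (by simp : (3 : ℕ∞) ≠ ⊤) h
  have hL4 : L'.ncard = 4 := by rw [bad_line_ncard M hW hC3, hn]
  have hLE : L' ⊆ M.E := fun x hx => hx.1.1
  have hcl : M✶.closure L' = L' := by
    have hsub : L' ⊆ M✶.closure L' := M✶.subset_closure L' (by rw [Matroid.dual_ground]; exact hLE)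
    have hclE : M✶.closure L' ⊆ M.E := by rw [← Matroid.dual_ground]; exact M✶.closure_subset_ground L'
    have hrk : M✶.eRk (M✶.closure L') ≤ 2 := by rw [M✶.eRk_closure_eq]; exact hL2.le
    have hle : (M✶.closure L').ncard ≤ L'.ncard := by rw [hL4]; exact hline _ hclE hrk
    exact (Set.eq_of_subset_of_ncard_le hsub hle (M.ground_finite.subset hclE)).symm
  refine ⟨hL2, hL4, ?_, hcl, hY5⟩
  intro x hx
  have := compl_closure_eq_dual_coloops M hW
  rw [hCdef, this] at hx
  exact hx.2

/-! ## The residue -/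

/-- **THE 12-ELEMENT CASE OF (P) ON A COSIMPLE MATROID WITH NO FIVE COLLINEAR POINTS IN THE DUAL** (night-1 g44,
§56.5–56.6): `M` coloop-free, without a series triple, of nullity `5` on `12` elements, `M✶` simple, every
rank-`≤ 2` set of `M✶` of at most four elements; then `UpFiveDeletionResidue M b` for every `b ∈ E`. -/
theorem upFiveDeletionResidue_of_cosimple (hcol : ∀ e, ¬ M.IsColoop e)
    (hnt : NoSeriesTriple M) (hν : M✶.eRank = 5) (hn : M.E.ncard = 12)
    (hs : ∀ p ∈ M.E, ∀ q ∈ M.E, p ≠ q → q ∉ M✶.closure {p})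
    (hline : ∀ L ⊆ M.E, M✶.eRk L ≤ 2 → L.ncard ≤ 4) {b : α} (hb : b ∈ M.E) :
    UpFiveDeletionResidue M b := by
  classical
  unfold UpFiveDeletionResidue
  have hn12 : 12 ≤ M.E.ncard := hn.ge
  -- the dual data
  have hnl : ∀ e ∈ M✶.E, M✶.IsNonloop e := fun e he =>
    dual_isNonloop_of_coloopFree M hcol (by rwa [Matroid.dual_ground] at he)
  have hs' : ∀ p ∈ M✶.E, ∀ q ∈ M✶.E, p ≠ q → q ∉ M✶.closure {p} := by
    intro p hp q hq
    rw [Matroid.dual_ground] at hp hq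
    exact hs p hp q hq
  -- the families
  set 𝔅 := {W ∈ biIndep M 5 | b ∈ W ∧ {t ∈ M.E \ W | t ∈ M.closure W}.ncard = 3} with h𝔅
  set Pr := {τ : Set α × α | τ.1 ∈ {Z ∈ biIndep M 6 | b ∉ Z} ∧ τ.2 ∈ {t ∈ (M.E \ τ.1) \ {b} | t ∈ M.closure τ.1}}
    with hPr
  have h𝔅fin : 𝔅.Finite := (biIndep_finite M 5).subset (fun _ h => h.1)
  have hPrfin : Pr.Finite := by
    refine ((avoid_finite M b 6).prod M.ground_finite).subset ?_
    rintro ⟨Z, t⟩ ⟨hZ, ht⟩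
    exact ⟨hZ, ht.1.1.1⟩
  -- notation for the pieces of a member
  let Cf : Set α → Set α := fun W => {t ∈ M.E \ W | t ∈ M.closure W}
  let Lf : Set α → Set α := fun W => (M.E \ W) \ Cf W
  let T : Set α → Set (Set α × α) := fun W => typeBTargets M✶ (W \ {b}) (Lf W) (Cf W) b
  -- (i) every bad member has ≥ 6 targets, all in Pr
  have hsix : ∀ W ∈ 𝔅, 6 ≤ (T W).ncard := by
    intro W hW
    obtain ⟨hW5, hbW, hC3⟩ := hW
    obtain ⟨hL2, hL4, hcolo, hcl, hY5⟩ := bad_structure M hν hn hline hW5 hC3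
    obtain ⟨c₁, c₂, c₃, h12, h13, h23, hCeq⟩ := Set.ncard_eq_three.mp hC3
    have hWB : M✶.IsBase W := isBase_dual_of_mem_biIndep_five M hν hW5
    have hLE : Lf W ⊆ M✶.E := by rw [Matroid.dual_ground]; exact fun x hx => hx.1.1
    have hCE : ∀ x ∈ Cf W, x ∈ M✶.E := by rw [Matroid.dual_ground]; exact fun x hx => hx.1.1
    have hbL : b ∉ M✶.closure (Lf W) := by rw [hcl]; exact fun h => h.1.2 hbW
    have hCL : Disjoint (Cf W) (Lf W) := Set.disjoint_sdiff_right
    have hRL : Disjoint (W \ {b}) (Lf W) := by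
      rw [Set.disjoint_left]; exact fun x hx hx' => hx'.1.2 hx.1
    have hCf : Cf W = ({c₁, c₂, c₃} : Set α) := hCeq
    have hCL' : Cf W ∪ Lf W = M.E \ W := Set.union_sdiff_cancel (fun x hx => hx.1)
    have hCunion : insert c₁ (insert c₂ (insert c₃ (Lf W))) = M.E \ W := by
      have : insert c₁ (insert c₂ (insert c₃ (Lf W))) = ({c₁, c₂, c₃} : Set α) ∪ Lf W := by
        ext x; simp only [Set.mem_insert_iff, Set.mem_union, Set.mem_singleton_iff]; tauto
      rw [this, ← hCf]; exact hCL'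
    have hC5 : M✶.eRk (insert c₁ (insert c₂ (insert c₃ (Lf W)))) = 5 := by rw [hCunion, hY5]
    have hc₁C : c₁ ∈ Cf W := by rw [hCf]; exact Set.mem_insert _ _
    have hc₂C : c₂ ∈ Cf W := by rw [hCf]; exact Set.mem_insert_of_mem _ (Set.mem_insert _ _)
    have hc₃C : c₃ ∈ Cf W := by rw [hCf]; exact Set.mem_insert_of_mem _ (Set.mem_insert_of_mem _ rfl)
    have hc₁ : c₁ ∈ M✶.E := hCE c₁ hc₁C
    have hc₂ : c₂ ∈ M✶.E := hCE c₂ hc₂C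
    have hc₃ : c₃ ∈ M✶.E := hCE c₃ hc₃C
    have hCL3 : Disjoint ({c₁, c₂, c₃} : Set α) (Lf W) := by rw [← hCf]; exact hCL
    have h6 := six_le_ncard_typeBTargets_of_simple hν hnl hs' hWB hbW hLE hL2 hL4 hbL hc₁ hc₂ hc₃ h12 h13 h23
      hC5 hCL3 hRL
    show 6 ≤ (typeBTargets M✶ (W \ {b}) (Lf W) (Cf W) b).ncard
    rw [hCf]; exact h6
  have hTsub : ∀ W ∈ 𝔅, T W ⊆ Pr := by
    intro W hW τ hτ
    obtain ⟨hW5, hbW, hC3⟩ := hW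
    obtain ⟨hL2, hL4, hcolo, hcl, hY5⟩ := bad_structure M hν hn hline hW5 hC3
    obtain ⟨ℓ, hℓ, c, hc, hval, hZ, hτ1, hτ2⟩ := hτ
    -- validity as spanning
    have hvalsp : M✶.Spanning (Lf W ∪ (Cf W \ {c}) ∪ {b}) := by
      have hYc : Lf W ∪ (Cf W \ {c}) = (M.E \ W) \ {c} := by
        ext x
        simp only [Lf, Cf, Set.mem_union, Set.mem_sdiff, Set.mem_setOf_eq, Set.mem_singleton_iff]
        constructor
        · rintro (⟨⟨hxE, hxW⟩, hxC⟩ | ⟨⟨⟨hxE, hxW⟩, hxcl⟩, hxc⟩)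
          · exact ⟨⟨hxE, hxW⟩, fun h => hxC ⟨⟨h ▸ hxE, h ▸ hxW⟩, h ▸ hc.2⟩⟩
          · exact ⟨⟨hxE, hxW⟩, hxc⟩
        · rintro ⟨⟨hxE, hxW⟩, hxc⟩
          by_cases hxcl : x ∈ M.closure W
          · exact Or.inr ⟨⟨⟨hxE, hxW⟩, hxcl⟩, hxc⟩
          · exact Or.inl ⟨⟨hxE, hxW⟩, fun h => hxcl h.2⟩
      have hcE : c ∈ M✶.E := by rw [Matroid.dual_ground]; exact hc.1.1
      have hc4 : M✶.eRk ((M.E \ W) \ {c}) = 4 := by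
        have hins : M✶.eRk (insert c ((M.E \ W) \ {c})) = M✶.eRk ((M.E \ W) \ {c}) + 1 :=
          Matroid.eRk_insert_eq_add_one ⟨hcE, hcolo c hc⟩
        rw [Set.insert_sdiff_singleton, Set.insert_eq_of_mem hc.1, hY5] at hins
        have h : M✶.eRk ((M.E \ W) \ {c}) + 1 = 4 + 1 := by rw [← hins]; norm_num
        exact WithTop.add_right_cancel (by simp : (1 : ℕ∞) ≠ ⊤) h
      have hbE : b ∈ M✶.E := by rwa [Matroid.dual_ground]
      have hbcl : b ∉ M✶.closure ((M.E \ W) \ {c}) := by rwa [← hYc]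
      have h5 : M✶.eRk (insert b ((M.E \ W) \ {c})) = 5 := by
        rw [Matroid.eRk_insert_eq_add_one ⟨hbE, hbcl⟩, hc4]; norm_num
      rw [hYc, Set.union_singleton]
      rw [Matroid.spanning_iff_eRk_le (Set.insert_subset hbE (fun x hx => by
        rw [Matroid.dual_ground]; exact hx.1.1)), h5, hν]
    obtain ⟨hZ6, hbZ, hcolZ⟩ := typeB_target_mem_avoid M hν hcol hnt hn12 hW5 hbW hC3 hℓ hc hZ hvalsp
    refine ⟨⟨?_, ?_⟩, ?_⟩
    · rw [hτ1]; exact hZ6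
    · rw [hτ1]; exact hbZ
    · rw [hτ1]; exact hcolZ τ.2 hτ2
  -- (ii) every pair has ≤ 5 bad preimages
  have hfive : ∀ τ ∈ Pr, {W ∈ 𝔅 | τ ∈ T W}.ncard ≤ 5 := by
    rintro ⟨Z, t⟩ ⟨hZ, ht⟩
    have hZ6 : Z.ncard = 6 := hZ.1.2.1
    have hbZ : b ∉ Z := hZ.2
    have hZE : Z ⊆ M✶.E := by rw [Matroid.dual_ground]; exact hZ.1.1
    refine ncard_preimages_le_five (t := t) hnl hs' hZ6 hbZ hZE {W ∈ 𝔅 | (Z, t) ∈ T W} ?_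
    intro W hW
    obtain ⟨⟨hW5, hbW, hC3⟩, hτ⟩ := hW
    obtain ⟨hL2, hL4, hcolo, hcl, hY5⟩ := bad_structure M hν hn hline hW5 hC3
    obtain ⟨ℓ, hℓ, c, hc, -, -, hτ1, hτ2⟩ := hτ
    refine ⟨by rw [Matroid.dual_ground]; exact hW5.1, hbW, Cf W, Lf W, ℓ, c, ?_, Set.disjoint_sdiff_right, hC3,
      hL2, hL4, hcolo, ?_, hℓ, hc, hτ2, hτ1⟩
    · rw [Matroid.dual_ground]
      exact (Set.union_sdiff_cancel (fun x hx => hx.1 : Cf W ⊆ M.E \ W)).symm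
    · rw [hcl, Set.disjoint_left]
      exact fun x hx hx' => hx'.1.2 hx
  -- (iii) the double count: 6 · #𝔅 ≤ 5 · #Pr
  have hcount : 6 * 𝔅.ncard ≤ 5 * Pr.ncard := by
    have h1 : ∑ W ∈ h𝔅fin.toFinset, {τ ∈ Pr | τ ∈ T W}.ncard = ∑ τ ∈ hPrfin.toFinset, {W ∈ 𝔅 | τ ∈ T W}.ncard :=
      sum_ncard_comm' h𝔅fin hPrfin (fun W τ => τ ∈ T W)
    have hlow : 6 * 𝔅.ncard ≤ ∑ W ∈ h𝔅fin.toFinset, {τ ∈ Pr | τ ∈ T W}.ncard := by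
      rw [Set.ncard_eq_toFinset_card _ h𝔅fin, mul_comm, ← smul_eq_mul, ← Finset.sum_const]
      refine Finset.sum_le_sum ?_
      intro W hW
      rw [Set.Finite.mem_toFinset] at hW
      have : {τ ∈ Pr | τ ∈ T W} = T W := by
        ext τ; exact ⟨fun h => h.2, fun h => ⟨hTsub W hW h, h⟩⟩
      rw [this]; exact hsix W hW
    have hup : ∑ τ ∈ hPrfin.toFinset, {W ∈ 𝔅 | τ ∈ T W}.ncard ≤ 5 * Pr.ncard := by
      rw [Set.ncard_eq_toFinset_card _ hPrfin, mul_comm, ← smul_eq_mul, ← Finset.sum_const]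
      refine Finset.sum_le_sum ?_
      intro τ hτ
      rw [Set.Finite.mem_toFinset] at hτ
      exact hfive τ hτ
    omega
  -- (iv) #Pr is the right-hand sum
  have hPrcard : Pr.ncard = ∑ Z ∈ (avoid_finite M b 6).toFinset, {t ∈ (M.E \ Z) \ {b} | t ∈ M.closure Z}.ncard :=
    ncard_pairs_eq_sum (avoid_finite M b 6) (fun Z => {t ∈ (M.E \ Z) \ {b} | t ∈ M.closure Z})
      (fun Z _ => M.ground_finite.subset (fun t ht => ht.1.1.1))
  -- assemble
  have hsum := sum_coloops_le M hcol hnt hν.le hn12 b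
  have hae : 𝔅.ncard = {W ∈ biIndep M 5 | b ∈ W ∧ {t ∈ M.E \ W | t ∈ M.closure W}.ncard = 3}.ncard := rfl
  rw [← hPrcard]
  omega

/-- **(↑)₅ AT EVERY ELEMENT OF A COSIMPLE MATROID OF NULLITY `5` ON `12` ELEMENTS WITHOUT FIVE COLLINEAR POINTS IN
THE DUAL** (night-1 g44, §56.6): the residue of `upFiveDeletionResidue_of_cosimple` fed to the deletion-averaging
step, whose inductive hypothesis on the 11-element contractions is the middle identity. -/
theorem upAt_five_of_cosimple (hloop : ∀ e, ¬ M.IsLoop e) (hcol : ∀ e, ¬ M.IsColoop e)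
    (hnt : NoSeriesTriple M) (hν : M✶.eRank = 5) (hn : M.E.ncard = 12)
    (hs : ∀ p ∈ M.E, ∀ q ∈ M.E, p ≠ q → q ∉ M✶.closure {p})
    (hline : ∀ L ⊆ M.E, M✶.eRk L ≤ 2 → L.ncard ≤ 4) {b : α} (hb : b ∈ M.E) : BiIndepUpAt M b 5 := by
  refine upAt_five_of_contract_of_residue M hloop hb (by omega) ?_
    (upFiveDeletionResidue_of_cosimple M hcol hnt hν hn hs hline hb)
  intro x hx
  have hbx : b ∈ (M.contract {x}).E := by
    rw [Matroid.contract_ground]; exact ⟨hb, fun h => hx.2 (by rw [Set.mem_singleton_iff] at h ⊢; exact h.symm)⟩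
  exact upAt_of_ncard_eq_middle (M.contract {x}) hbx (by rw [ncard_ground_contract_singleton M hx.1, hn])

end PercRepro
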